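import Summits.CriticalPhenomena.PercolationContinuityZ3.Theorems.PercNearOneGluingNoHeavyLowerTailAntitheticPendantTermTwo
import Summits.CriticalPhenomena.PercolationContinuityZ3.Theorems.PercNearOneGluingNoHeavyLowerTailAntitheticPendantTermTwoZ
import Summits.CriticalPhenomena.PercolationContinuityZ3.Theorems.PercNearOneGluingNoHeavyLowerTailAntitheticBoxes
import HarnessLib

/-!
# `NoHeavyLowerTail` (stmt-CriticalPhenomena-4575) — antithetic cluster pairs: PEELING PENDANT ARMS (PR1/PR2 of HOME/THEOREM-Theta.md iterated
# along paths, in super-odd form; prim-hp-2 gen 62)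

Support file (`--supports stmt-CriticalPhenomena-4575`, hull-port prover `prim-hp-2`, gen 62).  No definitions, no named facts, no sorries;
standard axioms.  VERTEX version; notation of …AntitheticPendantTermTwo: colourings `T ⊆ Sym2 V`, edge set `E`, source `s`,
`X T = openCluster (T ∩ E) s`, `Y T = openCluster (Tᶜ ∩ E) s`.  For a pair of test functions `K₁, K₂ : Set V → Set V → ℝ` write
`TII_E(y, z; K) = Σ_{T : y ∈ X T, z ∉ Y T} K₁(X T, Y T)·K₂(X T, Y T)` (the MIXED sum) and `⊕_E(y; K) = Σ_{T : y ∈ X T} K₁K₂(X T, Y T)`.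
The class 𝒮 of SUPER-ODD TWISTED-MONOTONE pairs is stable under `K ↦ K(· ∪ S(·), ·)` for any monotone set map `S`
(`Antithetic.Pendant.shift_mono`, `Antithetic.Pendant.shift_superodd`), which makes the pendant reductions iterate inside 𝒮:
* `Antithetic.Pendant.termTwo_pendant_K` (PR1 with `x := y`): `TII_{E ∪ {Py}}(y, z; K) = ½·TII_E(P, z; K(· ∪ {y}, ·))` for a leaf `y`;
* `Antithetic.Pendant.termTwo_pendant_split_K` (PR2 with `x := y`): `TII_{E ∪ {Qz}}(y, z; K) = ½·⊕_E(y; K(· ∪ z[Q ∈ ·], ·)) + ½·TII_E(y, Q; K)`;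
* `Antithetic.Pendant.termTwo_path_nonneg` (PR1 iterated along a pendant path `u 0 = P, …, u a = y` of fresh vertices):
  `(∀ K ∈ 𝒮, TII_E(P, z; K) ≥ 0) ⇒ (∀ K ∈ 𝒮, TII_{E ∪ path}(y, z; K) ≥ 0)`;
* `Antithetic.Pendant.termTwo_stub_nonneg` (PR2 iterated along `w 0 = Q, …, w b = z`):
  `(∀ j < b, ∀ K ∈ 𝒮, ⊕_{E ∪ stub_j}(y; K) ≥ 0) ∧ (∀ K ∈ 𝒮, TII_E(y, Q; K) ≥ 0) ⇒ (∀ K ∈ 𝒮, TII_{E ∪ stub_b}(y, z; K) ≥ 0)`.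
With THEOREM ⊕-CYCLE (…AntitheticCycleOplus) and PR4 (…AntitheticCycleTII) these give THEOREM Θ (…AntitheticHandle).
[cite: VandenbergHaggstromKahn2005, §1 p. 3 (open cluster `C_s`)]
-/

noncomputable section

namespace Summit.CriticalPhenomena.PercolationContinuityZ3.Theorems

open Literature.Probability.Percolation
open scoped Classical

namespace Antithetic

namespace Pendant

variable {V : Type*}

/-- Shifting the red argument by a monotone set map keeps twisted-monotonicity. [this work] -/
theorem shift_mono {K : Set V → Set V → ℝ} (hK : ∀ ⦃P P' Q Q' : Set V⦄, P ⊆ P' → Q' ⊆ Q → K P Q ≤ K P' Q')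
    (S : Set V → Set V) (hS : Monotone S) :
    ∀ ⦃P P' Q Q' : Set V⦄, P ⊆ P' → Q' ⊆ Q → K (P ∪ S P) Q ≤ K (P' ∪ S P') Q' :=
  fun _ _ _ _ hP hQ => hK (Set.union_subset_union hP (hS hP)) hQ

/-- Shifting the red argument by any set map that enlarges keeps super-oddness (for twisted-monotone `K`). [this work] -/
theorem shift_superodd {K : Set V → Set V → ℝ} (hK : ∀ ⦃P P' Q Q' : Set V⦄, P ⊆ P' → Q' ⊆ Q → K P Q ≤ K P' Q')
    (hso : ∀ P Q, 0 ≤ K P Q + K Q P) (S : Set V → Set V) :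
    ∀ P Q, 0 ≤ K (P ∪ S P) Q + K (Q ∪ S Q) P := by
  intro P Q
  have h1 : K P Q ≤ K (P ∪ S P) Q := hK Set.subset_union_left le_rfl
  have h2 : K Q P ≤ K (Q ∪ S Q) P := hK Set.subset_union_left le_rfl
  have h3 := hso P Q
  linarith

variable [Fintype V] {E : Set (Sym2 V)} {s : V}

/-- **PR1 in mixed form.**  For a leaf `y` (meeting only loops of `E`) attached by `Py` (`P ≠ y`, `s ≠ y`, `z ≠ y`) and any `K₁, K₂`:
`TII_{E ∪ {Py}}(y, z; K) = ½·TII_E(P, z; K(· ∪ {y}, ·))`. [this work] -/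
theorem termTwo_pendant_K {P y : V} (hy : ∀ f ∈ E, y ∈ f → f.IsDiag) (hPy : P ≠ y) (hsy : s ≠ y) {z : V} (hzy : z ≠ y)
    (K₁ K₂ : Set V → Set V → ℝ) :
    ∑ T ∈ Finset.univ.filter (fun T : Set (Sym2 V) =>
        y ∈ openCluster (T ∩ insert s(P, y) E) s ∧ z ∉ openCluster (Tᶜ ∩ insert s(P, y) E) s),
      K₁ (openCluster (T ∩ insert s(P, y) E) s) (openCluster (Tᶜ ∩ insert s(P, y) E) s) *
        K₂ (openCluster (T ∩ insert s(P, y) E) s) (openCluster (Tᶜ ∩ insert s(P, y) E) s) =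
    (1 / 2 : ℝ) * ∑ T ∈ Finset.univ.filter (fun T : Set (Sym2 V) => P ∈ openCluster (T ∩ E) s ∧ z ∉ openCluster (Tᶜ ∩ E) s),
      K₁ (openCluster (T ∩ E) s ∪ {y}) (openCluster (Tᶜ ∩ E) s) * K₂ (openCluster (T ∩ E) s ∪ {y}) (openCluster (Tᶜ ∩ E) s) := by
  have h := termTwo_pendant hy hPy hsy hzy y K₁ K₂
  have hL : ∀ T ∈ Finset.univ.filter (fun T : Set (Sym2 V) =>
      y ∈ openCluster (T ∩ insert s(P, y) E) s ∧ z ∉ openCluster (Tᶜ ∩ insert s(P, y) E) s),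
      K₁ (openCluster (T ∩ insert s(P, y) E) s ∪ {y}) (openCluster (Tᶜ ∩ insert s(P, y) E) s) *
        K₂ (openCluster (T ∩ insert s(P, y) E) s ∪ {y}) (openCluster (Tᶜ ∩ insert s(P, y) E) s) =
      K₁ (openCluster (T ∩ insert s(P, y) E) s) (openCluster (Tᶜ ∩ insert s(P, y) E) s) *
        K₂ (openCluster (T ∩ insert s(P, y) E) s) (openCluster (Tᶜ ∩ insert s(P, y) E) s) := by
    intro T hT
    have hyT := (Finset.mem_filter.1 hT).2.1
    rw [Set.union_eq_self_of_subset_right (Set.singleton_subset_iff.2 hyT)]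
  have hR : ∀ T : Set (Sym2 V), openCluster (T ∩ E) s ∪ {y} ∪ {y} = openCluster (T ∩ E) s ∪ {y} := fun T => by
    rw [Set.union_assoc, Set.union_self]
  simp only [hR] at h
  rw [Finset.sum_congr rfl hL] at h
  exact h

/-- **PR2 in mixed form.**  For a leaf `z` attached by `Qz` (`Q ≠ z`, `s ≠ z`, `y ≠ z`) and any `K₁, K₂`:
`TII_{E ∪ {Qz}}(y, z; K) = ½·⊕_E(y; K(· ∪ z[Q ∈ ·], ·)) + ½·TII_E(y, Q; K)`. [this work] -/
theorem termTwo_pendant_split_K {Q z : V} (hz : ∀ f ∈ E, z ∈ f → f.IsDiag) (hQz : Q ≠ z) (hsz : s ≠ z) {y : V} (hyz : y ≠ z)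
    (K₁ K₂ : Set V → Set V → ℝ) :
    ∑ T ∈ Finset.univ.filter (fun T : Set (Sym2 V) =>
        y ∈ openCluster (T ∩ insert s(Q, z) E) s ∧ z ∉ openCluster (Tᶜ ∩ insert s(Q, z) E) s),
      K₁ (openCluster (T ∩ insert s(Q, z) E) s) (openCluster (Tᶜ ∩ insert s(Q, z) E) s) *
        K₂ (openCluster (T ∩ insert s(Q, z) E) s) (openCluster (Tᶜ ∩ insert s(Q, z) E) s) =
    (1 / 2 : ℝ) * ∑ T ∈ Finset.univ.filter (fun T : Set (Sym2 V) => y ∈ openCluster (T ∩ E) s),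
      K₁ (openCluster (T ∩ E) s ∪ {v | v = z ∧ Q ∈ openCluster (T ∩ E) s}) (openCluster (Tᶜ ∩ E) s) *
        K₂ (openCluster (T ∩ E) s ∪ {v | v = z ∧ Q ∈ openCluster (T ∩ E) s}) (openCluster (Tᶜ ∩ E) s) +
    (1 / 2 : ℝ) * ∑ T ∈ Finset.univ.filter (fun T : Set (Sym2 V) => y ∈ openCluster (T ∩ E) s ∧ Q ∉ openCluster (Tᶜ ∩ E) s),
      K₁ (openCluster (T ∩ E) s) (openCluster (Tᶜ ∩ E) s) * K₂ (openCluster (T ∩ E) s) (openCluster (Tᶜ ∩ E) s) := by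
  have h := termTwo_pendant_split hz hQz hsz hyz y K₁ K₂
  have hL : ∀ T ∈ Finset.univ.filter (fun T : Set (Sym2 V) =>
      y ∈ openCluster (T ∩ insert s(Q, z) E) s ∧ z ∉ openCluster (Tᶜ ∩ insert s(Q, z) E) s),
      K₁ (openCluster (T ∩ insert s(Q, z) E) s ∪ {y}) (openCluster (Tᶜ ∩ insert s(Q, z) E) s) *
        K₂ (openCluster (T ∩ insert s(Q, z) E) s ∪ {y}) (openCluster (Tᶜ ∩ insert s(Q, z) E) s) =
      K₁ (openCluster (T ∩ insert s(Q, z) E) s) (openCluster (Tᶜ ∩ insert s(Q, z) E) s) *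
        K₂ (openCluster (T ∩ insert s(Q, z) E) s) (openCluster (Tᶜ ∩ insert s(Q, z) E) s) := by
    intro T hT
    have hyT := (Finset.mem_filter.1 hT).2.1
    rw [Set.union_eq_self_of_subset_right (Set.singleton_subset_iff.2 hyT)]
  have hR1 : ∀ T ∈ Finset.univ.filter (fun T : Set (Sym2 V) => y ∈ openCluster (T ∩ E) s),
      K₁ (openCluster (T ∩ E) s ∪ {v | v = z ∧ Q ∈ openCluster (T ∩ E) s} ∪ {y}) (openCluster (Tᶜ ∩ E) s) *
        K₂ (openCluster (T ∩ E) s ∪ {v | v = z ∧ Q ∈ openCluster (T ∩ E) s} ∪ {y}) (openCluster (Tᶜ ∩ E) s) =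
      K₁ (openCluster (T ∩ E) s ∪ {v | v = z ∧ Q ∈ openCluster (T ∩ E) s}) (openCluster (Tᶜ ∩ E) s) *
        K₂ (openCluster (T ∩ E) s ∪ {v | v = z ∧ Q ∈ openCluster (T ∩ E) s}) (openCluster (Tᶜ ∩ E) s) := by
    intro T hT
    have hyT := (Finset.mem_filter.1 hT).2
    have hsub : ({y} : Set V) ⊆ openCluster (T ∩ E) s ∪ {v | v = z ∧ Q ∈ openCluster (T ∩ E) s} :=
      Set.singleton_subset_iff.2 (Or.inl hyT)
    rw [Set.union_eq_self_of_subset_right hsub]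
  have hR2 : ∀ T ∈ Finset.univ.filter (fun T : Set (Sym2 V) => y ∈ openCluster (T ∩ E) s ∧ Q ∉ openCluster (Tᶜ ∩ E) s),
      K₁ (openCluster (T ∩ E) s ∪ {y}) (openCluster (Tᶜ ∩ E) s) * K₂ (openCluster (T ∩ E) s ∪ {y}) (openCluster (Tᶜ ∩ E) s) =
      K₁ (openCluster (T ∩ E) s) (openCluster (Tᶜ ∩ E) s) * K₂ (openCluster (T ∩ E) s) (openCluster (Tᶜ ∩ E) s) := by
    intro T hT
    have hyT := (Finset.mem_filter.1 hT).2.1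
    rw [Set.union_eq_self_of_subset_right (Set.singleton_subset_iff.2 hyT)]
  rw [Finset.sum_congr rfl hL, Finset.sum_congr rfl hR1, Finset.sum_congr rfl hR2] at h
  exact h

section Path

variable {u : ℕ → V} {a : ℕ}
  (hfresh : ∀ i, 0 < i → i ≤ a → ∀ f ∈ E, u i ∈ f → f.IsDiag)
  (huinj : ∀ i j, i ≤ a → j ≤ a → u i = u j → i = j) (hsu : ∀ i, 0 < i → i ≤ a → s ≠ u i)
include hfresh huinj hsu

/-- **PR1 iterated along a pendant path** `u 0 = P, u 1, …, u a = y` of fresh vertices (pairs `Cyc.edgeSet a u`), `z` off the path: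
if `TII_E(P, z; K) ≥ 0` for every super-odd twisted-monotone pair `K`, then `TII_{E ∪ path}(y, z; K) ≥ 0` for every such pair. [this work] -/
theorem termTwo_path_nonneg {z : V} (hzu : ∀ i, 0 < i → i ≤ a → z ≠ u i)
    (hbase : ∀ K₁ K₂ : Set V → Set V → ℝ,
      (∀ ⦃P P' Q Q' : Set V⦄, P ⊆ P' → Q' ⊆ Q → K₁ P Q ≤ K₁ P' Q') → (∀ P Q, 0 ≤ K₁ P Q + K₁ Q P) →
      (∀ ⦃P P' Q Q' : Set V⦄, P ⊆ P' → Q' ⊆ Q → K₂ P Q ≤ K₂ P' Q') → (∀ P Q, 0 ≤ K₂ P Q + K₂ Q P) →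
      0 ≤ ∑ T ∈ Finset.univ.filter (fun T : Set (Sym2 V) => u 0 ∈ openCluster (T ∩ E) s ∧ z ∉ openCluster (Tᶜ ∩ E) s),
        K₁ (openCluster (T ∩ E) s) (openCluster (Tᶜ ∩ E) s) * K₂ (openCluster (T ∩ E) s) (openCluster (Tᶜ ∩ E) s))
    {j : ℕ} (hj : j ≤ a) (K₁ K₂ : Set V → Set V → ℝ)
    (hK₁ : ∀ ⦃P P' Q Q' : Set V⦄, P ⊆ P' → Q' ⊆ Q → K₁ P Q ≤ K₁ P' Q') (hso₁ : ∀ P Q, 0 ≤ K₁ P Q + K₁ Q P)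
    (hK₂ : ∀ ⦃P P' Q Q' : Set V⦄, P ⊆ P' → Q' ⊆ Q → K₂ P Q ≤ K₂ P' Q') (hso₂ : ∀ P Q, 0 ≤ K₂ P Q + K₂ Q P) :
    0 ≤ ∑ T ∈ Finset.univ.filter (fun T : Set (Sym2 V) =>
        u j ∈ openCluster (T ∩ (E ∪ Cyc.edgeSet j u)) s ∧ z ∉ openCluster (Tᶜ ∩ (E ∪ Cyc.edgeSet j u)) s),
      K₁ (openCluster (T ∩ (E ∪ Cyc.edgeSet j u)) s) (openCluster (Tᶜ ∩ (E ∪ Cyc.edgeSet j u)) s) *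
        K₂ (openCluster (T ∩ (E ∪ Cyc.edgeSet j u)) s) (openCluster (Tᶜ ∩ (E ∪ Cyc.edgeSet j u)) s) := by
  induction j generalizing K₁ K₂ with
  | zero =>
    rw [Box.union_edgeSet_zero]
    exact hbase K₁ K₂ hK₁ hso₁ hK₂ hso₂
  | succ j ih =>
    have hj' : j < a := Nat.lt_of_succ_le hj
    rw [Box.union_edgeSet_succ, termTwo_pendant_K (Box.leaf_path hfresh huinj hj')
      (fun h => absurd (huinj j (j + 1) (by omega) hj h) (by omega)) (hsu (j + 1) (Nat.succ_pos j) hj)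
      (hzu (j + 1) (Nat.succ_pos j) hj)]
    refine mul_nonneg (by norm_num) ?_
    exact ih (Nat.le_of_succ_le hj) (fun P Q => K₁ (P ∪ {u (j + 1)}) Q) (fun P Q => K₂ (P ∪ {u (j + 1)}) Q)
      (shift_mono hK₁ (fun _ => {u (j + 1)}) monotone_const) (shift_superodd hK₁ hso₁ fun _ => {u (j + 1)})
      (shift_mono hK₂ (fun _ => {u (j + 1)}) monotone_const) (shift_superodd hK₂ hso₂ fun _ => {u (j + 1)})

/-- **PR2 iterated along a pendant stub** `u 0 = Q, u 1, …, u a = z` of fresh vertices, `y` off the stub: if `E ∪ stub_j` is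
⊕-positive at `y` for every `j < a` and `TII_E(y, Q; K) ≥ 0` for every super-odd twisted-monotone pair `K`, then
`TII_{E ∪ stub}(y, z; K) ≥ 0` for every such pair. [this work] -/
theorem termTwo_stub_nonneg {y : V} (hyu : ∀ i, 0 < i → i ≤ a → y ≠ u i)
    (hoplus : ∀ j, j < a → ∀ K₁ K₂ : Set V → Set V → ℝ,
      (∀ ⦃P P' Q Q' : Set V⦄, P ⊆ P' → Q' ⊆ Q → K₁ P Q ≤ K₁ P' Q') → (∀ P Q, 0 ≤ K₁ P Q + K₁ Q P) →
      (∀ ⦃P P' Q Q' : Set V⦄, P ⊆ P' → Q' ⊆ Q → K₂ P Q ≤ K₂ P' Q') → (∀ P Q, 0 ≤ K₂ P Q + K₂ Q P) →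
      0 ≤ ∑ T ∈ Finset.univ.filter (fun T : Set (Sym2 V) => y ∈ openCluster (T ∩ (E ∪ Cyc.edgeSet j u)) s),
        K₁ (openCluster (T ∩ (E ∪ Cyc.edgeSet j u)) s) (openCluster (Tᶜ ∩ (E ∪ Cyc.edgeSet j u)) s) *
          K₂ (openCluster (T ∩ (E ∪ Cyc.edgeSet j u)) s) (openCluster (Tᶜ ∩ (E ∪ Cyc.edgeSet j u)) s))
    (hbase : ∀ K₁ K₂ : Set V → Set V → ℝ,
      (∀ ⦃P P' Q Q' : Set V⦄, P ⊆ P' → Q' ⊆ Q → K₁ P Q ≤ K₁ P' Q') → (∀ P Q, 0 ≤ K₁ P Q + K₁ Q P) →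
      (∀ ⦃P P' Q Q' : Set V⦄, P ⊆ P' → Q' ⊆ Q → K₂ P Q ≤ K₂ P' Q') → (∀ P Q, 0 ≤ K₂ P Q + K₂ Q P) →
      0 ≤ ∑ T ∈ Finset.univ.filter (fun T : Set (Sym2 V) => y ∈ openCluster (T ∩ E) s ∧ u 0 ∉ openCluster (Tᶜ ∩ E) s),
        K₁ (openCluster (T ∩ E) s) (openCluster (Tᶜ ∩ E) s) * K₂ (openCluster (T ∩ E) s) (openCluster (Tᶜ ∩ E) s))
    {j : ℕ} (hj : j ≤ a) (K₁ K₂ : Set V → Set V → ℝ)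
    (hK₁ : ∀ ⦃P P' Q Q' : Set V⦄, P ⊆ P' → Q' ⊆ Q → K₁ P Q ≤ K₁ P' Q') (hso₁ : ∀ P Q, 0 ≤ K₁ P Q + K₁ Q P)
    (hK₂ : ∀ ⦃P P' Q Q' : Set V⦄, P ⊆ P' → Q' ⊆ Q → K₂ P Q ≤ K₂ P' Q') (hso₂ : ∀ P Q, 0 ≤ K₂ P Q + K₂ Q P) :
    0 ≤ ∑ T ∈ Finset.univ.filter (fun T : Set (Sym2 V) =>
        y ∈ openCluster (T ∩ (E ∪ Cyc.edgeSet j u)) s ∧ u j ∉ openCluster (Tᶜ ∩ (E ∪ Cyc.edgeSet j u)) s),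
      K₁ (openCluster (T ∩ (E ∪ Cyc.edgeSet j u)) s) (openCluster (Tᶜ ∩ (E ∪ Cyc.edgeSet j u)) s) *
        K₂ (openCluster (T ∩ (E ∪ Cyc.edgeSet j u)) s) (openCluster (Tᶜ ∩ (E ∪ Cyc.edgeSet j u)) s) := by
  induction j generalizing K₁ K₂ with
  | zero =>
    rw [Box.union_edgeSet_zero]
    exact hbase K₁ K₂ hK₁ hso₁ hK₂ hso₂
  | succ j ih =>
    have hj' : j < a := Nat.lt_of_succ_le hj
    rw [Box.union_edgeSet_succ, termTwo_pendant_split_K (Box.leaf_path hfresh huinj hj')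
      (fun h => absurd (huinj j (j + 1) (by omega) hj h) (by omega)) (hsu (j + 1) (Nat.succ_pos j) hj)
      (hyu (j + 1) (Nat.succ_pos j) hj)]
    refine add_nonneg (mul_nonneg (by norm_num) ?_) (mul_nonneg (by norm_num) ?_)
    · -- the ⊕-term, with the shifted pair `K(· ∪ z[Q ∈ ·], ·)`
      have hS : Monotone (fun P : Set V => {v | v = u (j + 1) ∧ u j ∈ P}) := by
        intro P P' hPP' v hv
        exact ⟨hv.1, hPP' hv.2⟩
      exact hoplus j hj' (fun P Q => K₁ (P ∪ {v | v = u (j + 1) ∧ u j ∈ P}) Q) (fun P Q => K₂ (P ∪ {v | v = u (j + 1) ∧ u j ∈ P}) Q)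
        (shift_mono hK₁ _ hS) (shift_superodd hK₁ hso₁ _) (shift_mono hK₂ _ hS) (shift_superodd hK₂ hso₂ _)
    · exact ih (Nat.le_of_succ_le hj) K₁ K₂ hK₁ hso₁ hK₂ hso₂

end Path

end Pendant

end Antithetic

end Summit.CriticalPhenomena.PercolationContinuityZ3.Theorems
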